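import Literature.Algebra.Polynomial.CasasAlvero.ClassificationSummary73
import Literature.Algebra.Polynomial.CasasAlvero.CharSeventyNineComplete
import Literature.Algebra.Polynomial.CasasAlvero.CharEightyThreeComplete
import Literature.Algebra.Polynomial.CasasAlvero.CharEightyNineComplete
import HarnessLib

/-!
# Casas-Alvero degrees in every prime characteristic `p ≤ 89`: the complete classification, one statement

Extends `ClassificationSummary73.lean` (`classification_of_char_le_73`) by the three primes `79, 83, 89`.  All three are GOOD primes
for degree `6` (none of them is among the `54` candidate bad primes of `Degree6CandidatesPrime.lean`; [CastryckLaterveerOunaies2012,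
Thm. 4]) and bad for every digit `7 ≤ a < p` (`Char79Digits`, `Char83Digits`, `Char89Digits`; the digit `8` in characteristics `79`
and `89` — for which no example with `≤ 4` inner monomials exists resp. was found by the coefficient-first search — by the
hexanomial / pentanomial of `Hexanomial.lean`, found by a witness-first linear search).  For EVERY prime `p ≤ 89` and EVERY field `K`
of characteristic `p`:

  `CA_d(K) ⟺ d = 0 ∨ d = a·p^k` with `1 ≤ a ≤ N(p)`,

`N(2) = 1`, `N(3) = 2`, `N(5) = N(7) = 3`, `N(11) = 4`, `N(p) = 6` for `p ∈ {17, 31, 41, 43, 53, 59, 71, 79, 83, 89}` (the good primes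
for degree `6` up to `89`) and `N(p) = 5` for `p ∈ {13, 19, 23, 29, 37, 47, 61, 67, 73}`.  No `sorry`, no new axioms; every case is a
landed per-characteristic classification.
-/

noncomputable section

open Polynomial

namespace Literature.Algebra.Polynomial.CasasAlvero

variable (K : Type*) [Field K]

/-- **Casas-Alvero degrees in every prime characteristic `p ≤ 89`, completely**: over every field of characteristic `p`,
`CA_d ⟺ d = 0 ∨ d = a·p^k` with `1 ≤ a ≤ N(p)`; `N(2) = 1`, `N(3) = 2`, `N(5) = N(7) = 3`, `N(11) = 4`,
`N(p) = 6` for `p = 17, 31, 41, 43, 53, 59, 71, 79, 83, 89`, and `N(p) = 5` for `p = 13, 19, 23, 29, 37, 47, 61, 67, 73`.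
[cite: GrafVonBothmerEtAl2007, Props. 2, 5, 6, 7] [cite: CastryckLaterveerOunaies2012, Thm. 4] -/
theorem classification_of_char_le_89 (p : ℕ) [CharP K p]
    (hp : p ∈ ({2, 3, 5, 7, 11, 13, 17, 19, 23, 29, 31, 37, 41, 43, 47, 53, 59, 61, 67, 71, 73, 79, 83, 89} : Finset ℕ))
    (d : ℕ) :
    HoldsInDegree K d ↔ d = 0 ∨ ∃ k a : ℕ, 0 < a ∧
      a ≤ (if p = 2 then 1 else if p = 3 then 2 else if p ≤ 7 then 3 else if p = 11 then 4
           else if p = 17 ∨ p = 31 ∨ p = 41 ∨ p = 43 ∨ p = 53 ∨ p = 59 ∨ p = 71 ∨ p = 79 ∨ p = 83 ∨ p = 89 then 6 else 5) ∧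
        d = a * p ^ k := by
  simp only [Finset.mem_insert, Finset.mem_singleton] at hp
  rcases hp with rfl | rfl | rfl | rfl | rfl | rfl | rfl | rfl | rfl | rfl | rfl | rfl | rfl | rfl | rfl | rfl | rfl | rfl | rfl |
    rfl | rfl | rfl | rfl | rfl
  · simpa using (classification_char_two K d).trans (or_congr_right digitForm_one)
  · simpa using (classification_char_three K d).trans (or_congr_right digitForm_two)
  · simpa using (classification_char_five K d).trans (or_congr_right digitForm_three)
  · simpa using (classification_char_seven K d).trans (or_congr_right digitForm_three)
  · simpa using (classification_char_eleven_complete K d).trans (or_congr_right digitForm_four)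
  · simpa using classification_char_thirteen_complete K d
  · simpa using classification_char_seventeen_complete K d
  · simpa using classification_char_nineteen_complete K d
  · simpa using classification_char_twentyThree_complete K d
  · simpa using classification_char_twentyNine_complete K d
  · simpa using classification_char_thirtyOne_complete K d
  · simpa using classification_char_thirtySeven_complete K d
  · simpa using classification_char_fortyOne_complete K d
  · simpa using classification_char_fortyThree_complete K d
  · simpa using classification_char_fortySeven_complete K d
  · simpa using classification_char_fiftyThree_complete K d
  · simpa using classification_char_fiftyNine_complete K d
  · simpa using classification_char_sixtyOne_complete K d
  · simpa using classification_char_sixtySeven_complete K d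
  · simpa using classification_char_seventyOne_complete K d
  · simpa using classification_char_seventyThree_complete K d
  · simpa using classification_char_seventyNine_complete K d
  · simpa using classification_char_eightyThree_complete K d
  · simpa using classification_char_eightyNine_complete K d

/-- the primes `p ≤ 89` all qualify: the hypothesis of `classification_of_char_le_89` from `p.Prime ∧ p ≤ 89`.
[cite: CastryckLaterveerOunaies2012, Thm. 4] -/
theorem mem_primes_le_89 {p : ℕ} (hp : p.Prime) (h89 : p ≤ 89) :
    p ∈ ({2, 3, 5, 7, 11, 13, 17, 19, 23, 29, 31, 37, 41, 43, 47, 53, 59, 61, 67, 71, 73, 79, 83, 89} : Finset ℕ) := by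
  interval_cases p <;> first | decide | exact absurd hp (by decide)

/-- **One statement for every prime characteristic `p ≤ 89`** (hypotheses `p.Prime`, `p ≤ 89` only).
[cite: GrafVonBothmerEtAl2007, Props. 2, 5, 6, 7] [cite: CastryckLaterveerOunaies2012, Thm. 4] -/
theorem classification_of_prime_char_le_89 (p : ℕ) [CharP K p] (hp : p.Prime) (h89 : p ≤ 89) (d : ℕ) :
    HoldsInDegree K d ↔ d = 0 ∨ ∃ k a : ℕ, 0 < a ∧
      a ≤ (if p = 2 then 1 else if p = 3 then 2 else if p ≤ 7 then 3 else if p = 11 then 4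
           else if p = 17 ∨ p = 31 ∨ p = 41 ∨ p = 43 ∨ p = 53 ∨ p = 59 ∨ p = 71 ∨ p = 79 ∨ p = 83 ∨ p = 89 then 6 else 5) ∧
        d = a * p ^ k :=
  classification_of_char_le_89 K p (mem_primes_le_89 hp h89) d

end Literature.Algebra.Polynomial.CasasAlvero
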